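/- Copyright: the b2b-balaban cell (near-miss cell 7), T⁴-continuum fan-out, ROUND-2 swarm of lineage t4-ne7b-p1
(node U5c COUNT member), seat t4-ne7b-formalise-leaf-09 (gen 2), with §2–§4 lemma shapes taken from seat
t4-ne7b-formalise-leaf-06 (gen 2)'s unfiled draft `HistoryConstantsSlackRoom` (cell journal 2026-08-20, STAND-DOWN note).
Released under the licence of the surrounding project. -/
import Summits.QuantumFields.BalabanUV.T4Continuum.Support.HistoryConstantsBridge
import Summits.QuantumFields.BalabanUV.T4Continuum.Support.HistoryConstantsSlack

/-!
# History constants: ROOM FOR A POSITIVE BIRTH-CREDIT SLACK `θ` — a choice of the symbolic constants (referee OI-17)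

Summits-side support leaf of the T⁴-continuum cell (rung (B)+1 on a FINITE torus only; NOT infinite volume, NOT the
mass gap, NOT the Clay statement; NOT a proof of the spine estimate NE7b).  Claim table
`t4/b2b-balaban-t4-ne7b-p1/LEAVES-NE7b.md` (junction of rows S9∕S9c∕S10 with the slack ENDs of S12∕S12d); it answers the
NE7b formalisation referee's open item **OI-17** (`t4/formal/NE7b/REFEREE.md` pass 11, divergence note DV-9): the slack
assembly ENDs (`HistoryAssemblyRealisePrice.hybridNE7_of_realisedReading_printedSlack`,
`HistoryAssemblyRealiseRunSlack.hybridNE7_of_realisedRun_printedSlack`) display a binder `hslack : C.a + θ ≤ O.γ₀·O.A₁²/2`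
and are useful only with `θ > 0`; «no tree lemma shows print's O(1)'s admit a positive `θ`.  Test: a lemma
`∃ θ > 0, C.a + θ ≤ O.γ₀·O.A₁²/2` from `Dominates C O`».

WHAT (all [folklore] real arithmetic on the lineage's OWN records of SYMBOLIC constants `T4PrintedShapeBanking.Consts` and
`HistoryConstants.PrintedO1s`; the tree's own vocabulary only — `PlacementBatch.lowerA`, `CountThresholdUniform.ThresholdOK`
∕ `thresholdOK_half`, `HistoryConstantsExist.Refines` ∕ `refines_lowerA`, `HistoryConstantsBridge.printedConsts`,
`HistoryConstantsSlack.slackT`; NO definition, no `Prop` fact minted, nothing printed asserted beyond the displayed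
positivity `PrintedO1s.Pos`, no constant specialised to a numeral — trigger conditions c1∕c2∕c6):
* §1 **`exists_pos_slack_iff`**: `(∃ θ, 0 < θ ∧ C.a + θ ≤ ½γ₀A₁²) ↔ C.a < ½γ₀A₁²` — the binder with a positive `θ` is
  EXACTLY strict birth domination.  Hence the literal test FAILS for a FIXED record, and must:
  **`not_exists_pos_slack_printedConsts`** — the print-shaped record `printedConsts O C` dominates print
  (`dominates_printedConsts`) and is `θ`-saturated (`a = ½γ₀A₁²`); **`exists_dominates_no_pos_slack`**: `Dominates C O`
  alone yields NO positive `θ`.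
* §2 **LOWERING THE BIRTH CONSTANT** (`lowerA C θ = {C with a := C.a − θ}`): `dominates_lowerA` (domination is monotone
  downwards in `a`, the only field that moves), `slack_lowerA : Dominates C O → (lowerA C θ).a + θ ≤ ½γ₀A₁²`,
  `thresholdOK_lowerA` (`θ < a`), `lowerA_a_lt` (strict domination for `θ > 0`), `birthMass_lowerA`, `lowerA_fields`.
* §3 **OI-17 IN THE ONLY FORM THAT CAN HOLD — the slack is a CHOICE OF THE MODEL RECORD**: `exists_pos_slack` (from
  `Dominates C O ∧ ThresholdOK C L r β₀`: the halved record `C′ := lowerA C (C.a∕2)` with `θ := C.a∕2 > 0` dominates, meets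
  `ThresholdOK`, refines `C`, keeps every other field, and satisfies `hslack`); and **`slackEND_constants_half`**: from the
  `C`-side binders of the slack END at `C` — `ThresholdOK C L rr β₀`, `0 < μ`, `d·log L + 2·log 2 ≤ κ₁`,
  `log (2 + birthMass C) ≤ E₀`, `1 ≤ A₀`, `p₀ ≤ pe`, `13 ≤ n₁` (every binder that does not mention the runs) — plus
  `Dominates C O`, ALL of them hold at `C′` TOGETHER WITH `0 < C.a∕2` and `hslack : C′.a + C.a∕2 ≤ ½γ₀A₁²`.  So `hslack`
  with `θ > 0` is DISCHARGEABLE BY HALVING THE BIRTH CONSTANT of any dominating record; the price is paid only in the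
  run-dependent displayed binders (`hir : irThresholdTLE C′ …` — a larger symbolic infrared threshold — and `hκ`, `hP`
  read at `C′`), which stay displayed at `C′` exactly as at any record.  Nothing is thereby said about the SIZE of print's
  O(1)'s; `θ` stays symbolic.
* §4 **AT THE PRINT-SHAPED RECORD, `θ = ¼γ₀A₁²` WRITTEN OUT**: `exists_pos_slack_printed` (under the displayed side
  conditions of `thresholdOK_printedConsts`).
* §5 **JUNCTION WITH ROW S9c** (`HistoryConstantsSlack`): `linear_le_slackT_lowerA` (the class-linear entropy `θ·(d′+1)`
  below the per-birth slack `slackT` at the lowered record — `linear_le_slackT` with its `hslack` DISCHARGED) and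
  `birthStepClause_lowerA` (the STRICT slack hypothesis of `birthStepClause_of_threshold` met at `lowerA C θ`, `θ > 0`).
* §6 sanity on the toy pair `O₁`∕`C₁` of `HistoryConstants`.

HONEST.  Bookkeeping between typed interfaces of the same lineage; discharges nothing of H3 ∕ (ID-a) ∕ (B) ∕ BetaPertH;
`BirthShapeNodup` is NOT retired by this file.  NE7b NOT proved; spine 0∕9.  HONEST DEPENDENCY (cell): continuum YM on T⁴
⇐ BetaPertH ∧ nine spine estimates (0/9 proved); BetaPertH ⇐ (D1) ∧ (D4) ∧ CAP+tail; G-an2-4 gates asym, D1 and NE2/3/4.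
-/

open Literature.MathematicalPhysics.QuantumFieldTheory.Balaban1983to89
open T4PersistenceDictionary T4PrintedShapeBanking T4CanonicalMenus
open Summit.QuantumFields.BalabanUV.T4Continuum.PlacementBatch
open Summit.QuantumFields.BalabanUV.T4Continuum.CountThresholdUniform
open Summit.QuantumFields.BalabanUV.T4Continuum.HistoryConstants
open Summit.QuantumFields.BalabanUV.T4Continuum.HistoryConstantsExist

namespace Summit.QuantumFields.BalabanUV.T4Continuum.HistoryConstantsSlackRecord

noncomputable section

/-! ## §1 A positive slack is exactly strict birth domination; `Dominates` alone does not give it -/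

section Iff

/-- **A POSITIVE SLACK EXISTS IFF THE MODEL's BIRTH CONSTANT IS STRICTLY BELOW PRINT's `½γ₀A₁²`.** [folklore] -/
theorem exists_pos_slack_iff {C : T4PrintedShapeBanking.Consts} {O : PrintedO1s} :
    (∃ θ : ℝ, 0 < θ ∧ C.a + θ ≤ O.γ₀ * O.A₁ ^ 2 / 2) ↔ C.a < O.γ₀ * O.A₁ ^ 2 / 2 := by
  constructor
  · rintro ⟨θ, hθ, h⟩
    linarith
  · intro h
    exact ⟨O.γ₀ * O.A₁ ^ 2 / 2 - C.a, by linarith, by linarith⟩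

/-- from a strict birth domination, the canonical slack `½γ₀A₁² − a` [folklore] -/
theorem pos_slack_of_lt {C : T4PrintedShapeBanking.Consts} {O : PrintedO1s} (h : C.a < O.γ₀ * O.A₁ ^ 2 / 2) :
    0 < O.γ₀ * O.A₁ ^ 2 / 2 - C.a ∧ C.a + (O.γ₀ * O.A₁ ^ 2 / 2 - C.a) ≤ O.γ₀ * O.A₁ ^ 2 / 2 :=
  ⟨by linarith, by linarith⟩

/-- a slack binder with `θ > 0` forces strict birth domination [folklore] -/
theorem lt_of_pos_slack {C : T4PrintedShapeBanking.Consts} {O : PrintedO1s} {θ : ℝ} (hθ : 0 < θ)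
    (h : C.a + θ ≤ O.γ₀ * O.A₁ ^ 2 / 2) : C.a < O.γ₀ * O.A₁ ^ 2 / 2 := by
  linarith

/-- **THE LITERAL TEST FAILS FOR A FIXED RECORD, AND MUST**: the print-shaped record `printedConsts O C` (which
dominates print, `dominates_printedConsts`) is `θ`-saturated — its birth constant IS `½γ₀A₁²`, so it admits no positive
slack. [folklore] -/
theorem not_exists_pos_slack_printedConsts (O : PrintedO1s) (C : T4PrintedShapeBanking.Consts) :
    ¬ ∃ θ : ℝ, 0 < θ ∧ (printedConsts O C).a + θ ≤ O.γ₀ * O.A₁ ^ 2 / 2 := by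
  rw [exists_pos_slack_iff, printedConsts_a]
  exact lt_irrefl _

/-- **`Dominates C O` ALONE YIELDS NO POSITIVE `θ`**: a dominating record without any positive slack exists (the
print-shaped one over any grid ∕ profile ∕ margins `C`). [folklore] -/
theorem exists_dominates_no_pos_slack {O : PrintedO1s} (hO : O.Pos) (C : T4PrintedShapeBanking.Consts) :
    ∃ C' : T4PrintedShapeBanking.Consts, Dominates C' O ∧ ¬ ∃ θ : ℝ, 0 < θ ∧ C'.a + θ ≤ O.γ₀ * O.A₁ ^ 2 / 2 :=
  ⟨printedConsts O C, dominates_printedConsts C hO, not_exists_pos_slack_printedConsts O C⟩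

end Iff

/-! ## §2 Lowering the quadratic birth constant keeps domination and frees a slack -/

section Lower

variable {C : T4PrintedShapeBanking.Consts} {O : PrintedO1s}

/-- **LOWERING `a` KEEPS DOMINATION**: only the birth clause of `Dominates` reads `a`, and it is monotone downwards;
every other entry of `lowerA C θ` is that of `C`. [folklore] -/
theorem dominates_lowerA (hD : Dominates C O) {θ : ℝ} (hθ : 0 ≤ θ) : Dominates (lowerA C θ) O where
  birth := by rw [lowerA_a]; linarith [hD.birth]
  renewal := hD.renewal
  surplus := hD.surplus
  window := hD.window
  floor := hD.floor
  size := hD.size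
  connClass := hD.connClass
  connector := hD.connector
  extension := hD.extension

/-- the lowered birth constant plus the slack is the original birth constant [folklore] -/
@[simp] theorem lowerA_a_add (C : T4PrintedShapeBanking.Consts) (θ : ℝ) : (lowerA C θ).a + θ = C.a := by
  rw [lowerA_a]
  ring

/-- **THE SLACK RELATION OF THE SLACK ENDs HOLDS AT THE LOWERED RECORD** with slack exactly the amount lowered:
`(lowerA C θ).a + θ ≤ ½γ₀A₁²` whenever `Dominates C O`. [folklore] -/
theorem slack_lowerA (hD : Dominates C O) (θ : ℝ) : (lowerA C θ).a + θ ≤ O.γ₀ * O.A₁ ^ 2 / 2 := by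
  rw [lowerA_a_add]
  exact hD.birth

/-- a dominating record lowered by `θ > 0` dominates STRICTLY in the birth constant (the hypothesis shape of row S9c's
`HistoryConstantsSlack.birthStepClause_of_threshold`) [folklore] -/
theorem lowerA_a_lt (hD : Dominates C O) {θ : ℝ} (hθ : 0 < θ) : (lowerA C θ).a < O.γ₀ * O.A₁ ^ 2 / 2 := by
  rw [lowerA_a]
  linarith [hD.birth]

/-- the complementary slack of the lowered record: `½γ₀A₁² − (a − θ) = (½γ₀A₁² − a) + θ ≥ θ` [folklore] -/
theorem le_sub_lowerA_a (hD : Dominates C O) (θ : ℝ) : θ ≤ O.γ₀ * O.A₁ ^ 2 / 2 - (lowerA C θ).a := by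
  rw [lowerA_a]
  linarith [hD.birth]

/-- **`ThresholdOK` PASSES TO THE LOWERED RECORD** as long as the lowered birth constant stays positive (`θ < a`); the
count's side conditions ask nothing else of `a`. [folklore] -/
theorem thresholdOK_lowerA {L r : ℕ} {β₀ : ℝ} (h : ThresholdOK C L r β₀) {θ : ℝ} (hθ : θ < C.a) :
    ThresholdOK (lowerA C θ) L r β₀ where
  valid := lowerA_valid h.valid _
  a_pos := by rw [lowerA_a]; linarith
  A₀_pos := by rw [lowerA_A₀]; exact h.A₀_pos
  one_le_L := h.one_le_L
  β₀_nonneg := h.β₀_nonneg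
  rq_lt := h.rq_lt

/-- the lowered record keeps the grid, the window power, the connector class, the floor∕size constants and the margins
(all `rfl`; `A₀ p₀ μ κ₁ n₁` are `PlacementBatch.lowerA_*`) [folklore] -/
theorem lowerA_fields (C : T4PrintedShapeBanking.Consts) (θ : ℝ) :
    (lowerA C θ).dC = C.dC ∧ (lowerA C θ).q' = C.q' ∧ (lowerA C θ).E₂ = C.E₂ ∧ (lowerA C θ).E₃ = C.E₃ ∧
      (lowerA C θ).E₀ = C.E₀ ∧ (lowerA C θ).Eb = C.Eb :=
  ⟨rfl, rfl, rfl, rfl, rfl, rfl⟩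

/-- the birth mass (a function of `Eb`, `μ` only) is unchanged by lowering `a` [folklore] -/
@[simp] theorem birthMass_lowerA (C : T4PrintedShapeBanking.Consts) (θ : ℝ) : birthMass (lowerA C θ) = birthMass C :=
  rfl

/-- `E₀` is unchanged [folklore] -/
@[simp] theorem lowerA_E₀ (C : T4PrintedShapeBanking.Consts) (θ : ℝ) : (lowerA C θ).E₀ = C.E₀ := rfl

end Lower

/-! ## §3 Referee OI-17: a positive slack is a choice of the record (halve the birth constant) -/

section Half

variable {C : T4PrintedShapeBanking.Consts} {O : PrintedO1s}

/-- **A DOMINATING RECORD UNDER THE COUNT's SIDE CONDITIONS ADMITS A POSITIVE SLACK AFTER HALVING ITS BIRTH CONSTANT**: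
with `C′ := lowerA C (C.a∕2)` and `θ := C.a∕2 > 0` (`ThresholdOK.a_pos`), `C′` dominates print's entries, meets
`ThresholdOK … L r β₀` (`CountThresholdUniform.thresholdOK_half`), refines `C` in the sense of row S10
(`HistoryConstantsExist.refines_lowerA` — so every socket transfer applies) and satisfies the slack ENDs' displayed
relation `C′.a + θ ≤ ½γ₀A₁²`. [folklore] -/
theorem exists_pos_slack (hD : Dominates C O) {L r : ℕ} {β₀ : ℝ} (h : ThresholdOK C L r β₀) :
    ∃ C' : T4PrintedShapeBanking.Consts, ∃ θ : ℝ, 0 < θ ∧ Dominates C' O ∧ ThresholdOK C' L r β₀ ∧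
      C'.a + θ ≤ O.γ₀ * O.A₁ ^ 2 / 2 ∧ Refines C' C ∧ C' = lowerA C (C.a / 2) ∧ θ = C.a / 2 :=
  have hθ : 0 ≤ C.a / 2 := by linarith [h.a_pos]
  ⟨lowerA C (C.a / 2), C.a / 2, by linarith [h.a_pos], dominates_lowerA hD hθ, thresholdOK_half h, slack_lowerA hD _,
    refines_lowerA h.A₀_pos.le hθ, rfl, rfl⟩

/-- **THE `C`-SIDE BINDERS OF THE SLACK END, ALL AT ONCE AT THE HALVED RECORD, WITH A POSITIVE SLACK.**  From the
binders the slack END `HistoryAssemblyRealisePrice.hybridNE7_of_realisedReading_printedSlack` asks of `C` without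
mentioning the runs — `ThresholdOK C L rr β₀`, `0 < C.μ`, `d·log L + 2·log 2 ≤ C.κ₁`, `log (2 + birthMass C) ≤ C.E₀`,
`1 ≤ C.A₀`, `C.p₀ ≤ pe`, `13 ≤ C.n₁` — plus `Dominates C O` (the printed-currency END's `hD`), the halved record
`C′ := lowerA C (C.a∕2)` satisfies the SAME binders, `Dominates C′ O`, and `hslack : C′.a + θ ≤ ½γ₀A₁²` with
`θ := C.a∕2 > 0`.  (The run-dependent binders `hir`, `hκ`, `hP` stay displayed at `C′` as at any record.) [folklore] -/
theorem slackEND_constants_half (hD : Dominates C O) {L rr : ℕ} {β₀ : ℝ} (h : ThresholdOK C L rr β₀) (hμ : 0 < C.μ)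
    {d : ℕ} (hκ₁ : (d : ℝ) * Real.log L + 2 * Real.log 2 ≤ C.κ₁) (hE₀ : Real.log (2 + birthMass C) ≤ C.E₀)
    (hA₀ : 1 ≤ C.A₀) {pe : ℕ} (hp₀ : C.p₀ ≤ pe) (hn₁ : 13 ≤ C.n₁) :
    Dominates (lowerA C (C.a / 2)) O ∧ ThresholdOK (lowerA C (C.a / 2)) L rr β₀ ∧ 0 < (lowerA C (C.a / 2)).μ ∧
      (d : ℝ) * Real.log L + 2 * Real.log 2 ≤ (lowerA C (C.a / 2)).κ₁ ∧
      Real.log (2 + birthMass (lowerA C (C.a / 2))) ≤ (lowerA C (C.a / 2)).E₀ ∧ 1 ≤ (lowerA C (C.a / 2)).A₀ ∧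
      (lowerA C (C.a / 2)).p₀ ≤ pe ∧ 13 ≤ (lowerA C (C.a / 2)).n₁ ∧
      0 < C.a / 2 ∧ (lowerA C (C.a / 2)).a + C.a / 2 ≤ O.γ₀ * O.A₁ ^ 2 / 2 :=
  ⟨dominates_lowerA hD (by linarith [h.a_pos]), thresholdOK_half h, by simpa only [lowerA_μ] using hμ,
    by simpa only [lowerA_κ₁] using hκ₁, by simpa only [birthMass_lowerA, lowerA_E₀] using hE₀,
    by simpa only [lowerA_A₀] using hA₀, by simpa only [lowerA_p₀] using hp₀, by simpa only [lowerA_n₁] using hn₁,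
    by linarith [h.a_pos], slack_lowerA hD _⟩

end Half

/-! ## §4 At the print-shaped record: the slack `θ = ¼γ₀A₁²` written out -/

section Printed

variable {O : PrintedO1s} (C : T4PrintedShapeBanking.Consts)

/-- halving the print-shaped record's birth constant: `½·(½γ₀A₁²) = ¼γ₀A₁²` [folklore] -/
theorem printedConsts_a_half (O : PrintedO1s) : (printedConsts O C).a / 2 = O.γ₀ * O.A₁ ^ 2 / 4 := by
  rw [printedConsts_a]
  ring

/-- **AT THE PRINT-SHAPED RECORD, WITH THE SLACK WRITTEN OUT**: under the displayed side conditions of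
`HistoryConstantsBridge.thresholdOK_printedConsts` (`O.Pos`, margins `≥ 0`, `fatWait (2d) ≤ n₁`, `0 < A₀`, `1 ≤ L`,
`0 ≤ β₀`, `r·(d+2) < p₀`) the record `lowerA (printedConsts O C) (¼γ₀A₁²)` dominates print's entries, meets
`ThresholdOK`, refines the print-shaped record, and leaves the slack `θ = ¼γ₀A₁² > 0`: `a + θ ≤ ½γ₀A₁²` (indeed `=`).
[folklore] -/
theorem exists_pos_slack_printed (hO : O.Pos) (hκ : 0 ≤ C.κ₁) (hE₀ : 0 ≤ C.E₀) (hEb : 0 ≤ C.Eb) (hμ : 0 ≤ C.μ)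
    (hn : fatWait (2 * O.d) ≤ C.n₁) (hA : 0 < C.A₀) {L r : ℕ} (hL : 1 ≤ L) {β₀ : ℝ} (hβ : 0 ≤ β₀)
    (hrq : r * (O.d + 2) < C.p₀) :
    0 < O.γ₀ * O.A₁ ^ 2 / 4 ∧
      Dominates (lowerA (printedConsts O C) (O.γ₀ * O.A₁ ^ 2 / 4)) O ∧
      ThresholdOK (lowerA (printedConsts O C) (O.γ₀ * O.A₁ ^ 2 / 4)) L r β₀ ∧
      (lowerA (printedConsts O C) (O.γ₀ * O.A₁ ^ 2 / 4)).a + O.γ₀ * O.A₁ ^ 2 / 4 ≤ O.γ₀ * O.A₁ ^ 2 / 2 ∧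
      Refines (lowerA (printedConsts O C) (O.γ₀ * O.A₁ ^ 2 / 4)) (printedConsts O C) := by
  have hpos : 0 < O.γ₀ * O.A₁ ^ 2 / 4 := by
    have := hO.γ₀_pos
    have := hO.A₁_pos
    positivity
  have hT := thresholdOK_printedConsts C hO hκ hE₀ hEb hμ hn hA hL hβ hrq
  refine ⟨hpos, dominates_lowerA (dominates_printedConsts C hO) hpos.le, ?_,
    slack_lowerA (dominates_printedConsts C hO) _, refines_lowerA (Cp := printedConsts O C) hA.le hpos.le⟩
  rw [← printedConsts_a_half C O]
  exact thresholdOK_half hT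

/-- the lowered print-shaped record's birth constant IS `¼γ₀A₁²` and the slack inequality is saturated [folklore] -/
theorem lowerA_printedConsts_a (O : PrintedO1s) :
    (lowerA (printedConsts O C) (O.γ₀ * O.A₁ ^ 2 / 4)).a = O.γ₀ * O.A₁ ^ 2 / 4 ∧
      (lowerA (printedConsts O C) (O.γ₀ * O.A₁ ^ 2 / 4)).a + O.γ₀ * O.A₁ ^ 2 / 4 = O.γ₀ * O.A₁ ^ 2 / 2 := by
  rw [lowerA_a, printedConsts_a]
  constructor <;> ring

end Printed

/-! ## §5 Junction with row S9c: the per-birth slack `slackT` at the lowered record -/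

section S9c

variable {C : T4PrintedShapeBanking.Consts} {O : PrintedO1s}

/-- **(a) CLASS-LINEAR ENTROPY AT THE LOWERED RECORD**: `θ·(d′+1) ≤ slackT O (lowerA C θ) g e` at a birth with profile
`≥ 1` — `HistoryConstantsSlack.linear_le_slackT` with its `hslack` DISCHARGED by `slack_lowerA`. [folklore] -/
theorem linear_le_slackT_lowerA (hD : Dominates C O) {θ : ℝ} (hθ : 0 ≤ θ) {g : ℕ → ℝ} {e : PEv} (h0 : e.kind = 0)
    (hP : 1 ≤ p0Profile C.A₀ C.p₀ (g e.step)) :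
    θ * ((e.fat : ℝ) + 1) ≤ slackT O (lowerA C θ) g e :=
  linear_le_slackT hθ (slack_lowerA hD θ) h0 (by simpa only [lowerA_A₀, lowerA_p₀] using hP)

/-- **(b) THE BIRTH-STEP CLAUSE AT THE LOWERED RECORD**: for `θ > 0` the lowered record meets the STRICT slack hypothesis
of `HistoryConstantsSlack.birthStepClause_of_threshold`, so print's birth-step size term is absorbed above the symbolic
threshold `birthStepThreshold O (lowerA C θ) L` (instantiation; every other hypothesis displayed verbatim, the profile
read at `C`'s `A₀`, `p₀`). [folklore] -/
theorem birthStepClause_lowerA (hO : O.Pos) (hD : Dominates C O) {θ : ℝ} (hθ : 0 < θ) {L r : ℕ} (hL : 1 ≤ L)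
    (hA : 0 < C.A₀) (hexp : r * (O.d + 1) + 1 ≤ 2 * C.p₀) {R : ℕ → ℕ} {g : ℕ → ℝ} {s : ℕ}
    (hR : B14.IsRj L r (g s) (R s)) (hx1 : 1 ≤ Real.log ((g s) ^ 2)⁻¹)
    (hthr : birthStepThreshold O (lowerA C θ) L ≤ Real.log ((g s) ^ 2)⁻¹) :
    O.o80 * O.M ^ O.d * (R s : ℝ) ^ (O.d + 1) ≤
      (O.γ₀ * O.A₁ ^ 2 / 2 - (lowerA C θ).a) * p0Profile C.A₀ C.p₀ (g s) ^ 2 := by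
  simpa only [lowerA_A₀, lowerA_p₀] using
    birthStepClause_of_threshold hO hL (lowerA_a_lt hD hθ) (by simpa only [lowerA_A₀] using hA)
      (by simpa only [lowerA_p₀] using hexp) hR hx1 hthr

/-- … in particular `θ·p₀(g_s)²` itself is room for print's birth-step term: `o80·M^d·R_s^{d+1} ≤ (½γ₀A₁² − a + θ)·p₀²`
and `θ ≤ ½γ₀A₁² − a + θ` (`le_sub_lowerA_a`). [folklore] -/
theorem birthStep_room_lowerA (hD : Dominates C O) (θ : ℝ) (P : ℝ) :
    θ * P ^ 2 ≤ (O.γ₀ * O.A₁ ^ 2 / 2 - (lowerA C θ).a) * P ^ 2 :=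
  mul_le_mul_of_nonneg_right (le_sub_lowerA_a hD θ) (sq_nonneg P)

end S9c

/-! ## §6 Sanity: the toy pair of `HistoryConstants` -/

namespace Sanity

open HistoryConstants.Sanity

/-- on the toy pair (`C₁.a = 1 = ½·γ₀·A₁²` for `O₁`): the toy record is `θ`-saturated — it dominates `O₁` with NO positive
slack (the negative half of OI-17 decided) [folklore] -/
example : Dominates C₁ O₁ ∧ ¬ ∃ θ : ℝ, 0 < θ ∧ C₁.a + θ ≤ O₁.γ₀ * O₁.A₁ ^ 2 / 2 :=
  ⟨dominates_C₁_O₁, by rw [exists_pos_slack_iff]; norm_num [C₁, O₁]⟩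

/-- halving gives `a = ½`, slack `½`, and `½ + ½ ≤ 1`; the halved toy record still dominates `O₁` [folklore] -/
example : (lowerA C₁ (C₁.a / 2)).a + C₁.a / 2 ≤ O₁.γ₀ * O₁.A₁ ^ 2 / 2 ∧ Dominates (lowerA C₁ (C₁.a / 2)) O₁ :=
  ⟨slack_lowerA dominates_C₁_O₁ _, dominates_lowerA dominates_C₁_O₁ (by norm_num [C₁])⟩

/-- at the toy print-shaped record the written-out slack is `¼·2·1 = ½ > 0` [folklore] -/
example : 0 < O₁.γ₀ * O₁.A₁ ^ 2 / 4 := by norm_num [O₁]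

end Sanity

end

end Summit.QuantumFields.BalabanUV.T4Continuum.HistoryConstantsSlackRecord
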